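import Summits.CriticalPhenomena.CardyFormulaZ2.Theses.CardySelfDualSegment

/-!
# `ContinuitySweep` (stmt-CriticalPhenomena-14382) — the continuity method on `[0,1]` read off

Route `CardySelfDualSegment` of `CriticalPhenomena/CardyFormulaZ2`. The support item
`ContinuitySweep` is the glue
`SmirnovBasePoint → SegmentOpen → SegmentClosed → UniformMarginality → UniformBoxCrossing → Target`:
with `G = {t ∈ [0,1] | ∃ α, 0 < Im α ∧ CardyMod t α}`,

* `SegmentOpen` fed by `UniformMarginality` gives `IsOpen G`;
* `SegmentClosed` fed by `UniformBoxCrossing` and `UniformMarginality` gives `IsClosed G`;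
* `SmirnovBasePoint` gives `0 ∈ G` with modulus `triZeta = exp(iπ/3)`, whose imaginary part
  `sin(π/3)` is positive;
* `unitInterval` is preconnected (`Subtype.preconnectedSpace isPreconnected_Icc`), so the clopen
  set `G` is all of `[0,1]` (`IsClopen.eq_univ`), which read pointwise is `Target`.

Pure topology; no percolation input beyond the hypotheses. This is the same sweep as the body of the
route's deciding theorem `closes`, evaluated at every `t` instead of at `t = 1`.

References: S. Smirnov, C. R. Acad. Sci. Paris 333 (2001) (base point); V. Beffara,
*Is critical 2D percolation universal?* (2008), §2 (moving modulus).
-/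

namespace Summit.CriticalPhenomena.CardyFormulaZ2.Theorems

open Summit.CriticalPhenomena.CardyFormulaZ2.Theses.CardySelfDualSegment

/-- **Continuity sweep** (closes item stmt-CriticalPhenomena-14382): the route decl
`ContinuitySweep`, i.e. `SmirnovBasePoint → SegmentOpen → SegmentClosed → UniformMarginality →
UniformBoxCrossing → Target`. Proof: the set `G` of parameters `t ∈ [0,1]` admitting a modulus
`α` in the upper half-plane with `CardyMod t α` is open (`SegmentOpen` + `UniformMarginality`),
closed (`SegmentClosed` + `UniformBoxCrossing` + `UniformMarginality`) and contains `0`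
(`SmirnovBasePoint`, `Im triZeta = sin(π/3) > 0`); `unitInterval` is preconnected, hence
`G = univ`, which is `Target` pointwise. -/
theorem continuitySweep_proof :
    Summit.CriticalPhenomena.CardyFormulaZ2.Theses.CardySelfDualSegment.ContinuitySweep := by
  unfold ContinuitySweep
  intro hB hO hC hM hX t
  -- G is open (SegmentOpen fed by UniformMarginality) and closed (SegmentClosed fed by
  -- UniformBoxCrossing and UniformMarginality).
  have hGo := hO hM
  have hGc := hC hX hM
  have hclopen : IsClopen _ := ⟨hGc, hGo⟩
  -- 0 ∈ G: the Smirnov base point has modulus ζ = exp(iπ/3) with Im ζ = sin(π/3) > 0.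
  have hz : 0 < Literature.Probability.LatticeModels.triZeta.im := by
    unfold Literature.Probability.LatticeModels.triZeta
    rw [Complex.exp_im]
    have hre : ((Real.pi : ℂ) * Complex.I / 3).re = 0 := by simp
    have him : ((Real.pi : ℂ) * Complex.I / 3).im = Real.pi / 3 := by simp
    rw [hre, him, Real.exp_zero, one_mul]
    exact Real.sin_pos_of_pos_of_lt_pi (by positivity) (by linarith [Real.pi_pos])
  -- unitInterval is preconnected, so the clopen G containing 0 is everything.
  haveI : PreconnectedSpace unitInterval := Subtype.preconnectedSpace isPreconnected_Icc
  have huniv := hclopen.eq_univ ⟨0, Literature.Probability.LatticeModels.triZeta, hz, hB⟩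
  exact (Set.eq_univ_iff_forall.mp huniv) t

end Summit.CriticalPhenomena.CardyFormulaZ2.Theorems
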